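import Literature.Geometry.Lorentzian.LocalCausalityExp
import Literature.Geometry.Lorentzian.CausalityChronologyProofs
import Literature.Geometry.Lorentzian.CausalityPushUp
import Literature.Geometry.Lorentzian.CauchyHypersurfaceCausalProofs
import HarnessLib

/-!
# A future timelike curve runs into the chronological past of its future endpoint
# (O'Neill 1983, Ch. 14, Lemma 14.2 and Prop. 10.46, local form)

Let `γ` be a future timelike curve on `[a, b)` of a time-oriented Lorentzian manifold with a
future endpoint `m = lim_{t → b⁻} γ(t)`. Then **`m ∈ I⁺(γ a)`**
(`LorentzianMetric.mem_chronologicalFuture_of_tendsto`). The curve itself does not witness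
this — it need not be differentiable at `b` — and the closure `m ∈ cl I⁺(γ a)` is all that
transitivity gives. The missing strictness is local causality in a normal neighbourhood of `m`
(O'Neill 1983, Ch. 5, Lemma 5.33; Ch. 14, Lemma 14.2): read the tail `γ|[a₁, b)` of the curve, which
lies in a uniformly normal neighbourhood `W` of `m`, in the exponential chart at `o = γ(a₁)`
through the two-point inverse `Ξ` of `exp` (`exists_twoPoint_expInverse`); the chart curve
`β = exp_o⁻¹ ∘ γ` starts at `0` with future timelike velocity, so it enters the open future
timecone at once, and then `g_o(β, β)` is strictly decreasing (`radial_timecone_invariance`);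
hence the limit `v = exp_o⁻¹(m) = lim β` satisfies `g_o(v, v) < 0`: `v` is future timelike and
`m = exp_o(v) ∈ I⁺(o)` (`expMap_mem_chronologicalFuture`), so `m ∈ I⁺(γ a)` by transitivity.
This is the endpoint lemma used in the causal theory of Cauchy developments (Hawking–Ellis 1973,
§6.5–6.6) to trade limits of timelike curves for chronological relations.

Everything is proved; no definitions and no named facts are introduced (D-0026).

## References

* B. O'Neill, *Semi-Riemannian geometry with applications to relativity*, Academic Press 1983,
  Ch. 5, Lemma 5.33 (p. 146); Ch. 10, Prop. 10.46 (p. 294); Ch. 14, Lemma 14.2 (p. 402).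
* S. W. Hawking, G. F. R. Ellis, *The large scale structure of space-time*, CUP 1973, §6.5.
-/

noncomputable section

open Bundle Set Filter Function
open scoped Manifold ContDiff Topology

namespace Literature.Geometry.Lorentzian

open Literature.Geometry.Riemannian

variable {E : Type*} [NormedAddCommGroup E] [NormedSpace ℝ E] {H : Type*} [TopologicalSpace H]
  {I : ModelWithCorners ℝ E H} {M : Type*} [TopologicalSpace M] [ChartedSpace H M]
  [IsManifold I ∞ M] [FiniteDimensional ℝ E] [CompleteSpace E] [T2Space M] [I.Boundaryless]
  {n : ℕ∞ω} {g : LorentzianMetric I n M} [g.HasLeviCivita]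
  [CovariantDerivative.ContMDiffCovariantDerivative g.leviCivita 1] (τ : TimeOrientation g)

/-- **A future timelike curve with a future endpoint `m` lies in the chronological past of `m`**
(O'Neill 1983, Ch. 14, Lemma 14.2 with Ch. 5, Lemma 5.33, local form): if `γ` is a future
timelike curve on `[a, b)` (`a < b`) and `γ(t) → m` as `t → b⁻`, then `m ∈ I⁺(γ a)`. See the
module docstring for the proof. [cite: ONeillSemiRiemannian1983, Ch. 14, Lemma 14.2 (p. 402); Ch. 5, Lemma 5.33 (p. 146)] -/
theorem LorentzianMetric.mem_chronologicalFuture_of_tendsto (hn : (∞ : ℕ∞ω) ≤ n)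
    {γ : ℝ → M} {a b : ℝ} (hab : a < b) (hγ : g.IsFutureTimelikeCurveOn τ γ (Ico a b))
    {m : M} (hm : Tendsto γ (𝓝[<] b) (𝓝 m)) :
    m ∈ g.chronologicalFuture τ {γ a} := by
  haveI : Fact (1 ≤ n) := ⟨le_trans (by exact_mod_cast le_top) hn⟩
  haveI := contMDiffCovariantDerivative_leviCivita_infty g.toPseudoRiemannianMetric hn
  set cov := g.leviCivita with hcov
  -- the uniformly normal neighbourhood and the two-point inverse at `m`
  obtain ⟨W, Src, Ξ, hWo, hmW, hWsrc, hSo, hS0, hSdom, hinjF, hΞ, hΞs, hΦs⟩ :=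
    exists_twoPoint_expInverse (cov := cov) m
  set e := trivializationAt E (TangentSpace I : M → Type _) m with he
  have hbase : e.baseSet = (chartAt H m).source := TangentBundle.trivializationAt_baseSet m
  -- a tail `[a₁, b)` of the curve inside `W`
  have hWev : ∀ᶠ t in 𝓝[<] b, γ t ∈ W := hm (hWo.mem_nhds hmW)
  obtain ⟨l, hlb, hl⟩ := mem_nhdsLT_iff_exists_Ioo_subset.1 hWev
  set a₁ : ℝ := (max a l + b) / 2 with ha₁
  have haa₁ : a < a₁ := by
    have : max a l < b := max_lt hab hlb
    rw [ha₁]; linarith [le_max_left a l]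
  have hla₁ : l < a₁ := by
    have : max a l < b := max_lt hab hlb
    rw [ha₁]; linarith [le_max_right a l]
  have ha₁b : a₁ < b := by
    have : max a l < b := max_lt hab hlb
    rw [ha₁]; linarith
  have hγW : ∀ t ∈ Ico a₁ b, γ t ∈ W := fun t ht ↦ hl ⟨hla₁.trans_le ht.1, ht.2⟩
  have hsub : Ico a₁ b ⊆ Ico a b := fun t ht ↦ ⟨haa₁.le.trans ht.1, ht.2⟩
  have hγ₁ : g.IsFutureTimelikeCurveOn τ γ (Ico a₁ b) := hγ.mono hsub
  have hγc : g.IsFutureCausalCurveOn τ γ (Ico a₁ b) := fun t ht ↦ ⟨(hγ₁ t ht).1, (hγ₁ t ht).2.2⟩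
  -- it suffices to reach `m` from `o = γ a₁`
  set o : M := γ a₁ with ho
  have hoW : o ∈ W := hγW a₁ ⟨le_rfl, ha₁b⟩
  suffices hmo : m ∈ g.chronologicalFuture τ {o} by
    have h1 : o ∈ g.chronologicalFuture τ {γ a} :=
      LorentzianMetric.mem_chronologicalFuture_iff.2 ⟨γ a, rfl, γ, a, a₁, haa₁,
        hγ.mono (fun t ht ↦ ⟨ht.1, lt_of_le_of_lt ht.2 ha₁b⟩), rfl, rfl⟩
    exact mem_chronologicalFuture_trans h1 hmo
  have hγcont : ∀ t ∈ Ico a₁ b, ContinuousAt γ t := fun t ht ↦ (hγ₁ t ht).1.continuousAt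
  have hγnear : ∀ t ∈ Ico a₁ b, ∀ᶠ s in 𝓝 t, γ s ∈ W := fun t ht ↦
    (hγcont t ht).preimage_mem_nhds (hWo.mem_nhds (hγW t ht))
  /- (A) the chart curve at `o`: `β = L ∘ Ξ(o, ·) ∘ γ` with `L = e.symmL ℝ o`; its derivative,
    domain and the eventual equality `exp_o ∘ β = γ`. -/
  have hoe : o ∈ e.baseSet := by rw [hbase]; exact hWsrc hoW
  set L : E →L[ℝ] E := e.symmL ℝ o with hL
  set K : M → E := fun z ↦ Ξ o z with hK
  have hKs : ContMDiffOn I 𝓘(ℝ, E) ∞ K W := by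
    have h1 : ContMDiff I (I.prod I) ∞ (fun z : M ↦ (o, z)) := contMDiff_const.prodMk contMDiff_id
    exact hΞs.comp h1.contMDiffOn fun z hz ↦ ⟨hoW, hz⟩
  set β : ℝ → E := fun t ↦ L (K (γ t)) with hβ
  have hdiff : ∀ t ∈ Ico a₁ b, DifferentiableAt ℝ (fun s ↦ K (γ s)) t := by
    intro t ht
    have hKd : MDifferentiableAt I 𝓘(ℝ, E) K (γ t) :=
      (hKs.contMDiffAt (hWo.mem_nhds (hγW t ht))).mdifferentiableAt (by simp)
    have h := hKd.comp t (hγ₁ t ht).1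
    exact mdifferentiableAt_iff_differentiableAt.1 h
  set β' : ℝ → E := fun t ↦ L (deriv (fun s ↦ K (γ s)) t) with hβ'
  have hβd : ∀ t ∈ Ico a₁ b, HasDerivAt β (β' t) t := fun t ht ↦
    L.hasFDerivAt.comp_hasDerivAt t (hdiff t ht).hasDerivAt
  have hβdom : ∀ t ∈ Ico a₁ b, (β t : TangentSpace I o) ∈ expDomain cov o := fun t ht ↦
    (hSdom _ (hΞ o hoW (γ t) (hγW t ht)).1).2
  have hβev : ∀ t ∈ Ico a₁ b, (fun s ↦ expMap cov o (β s)) =ᶠ[𝓝 t] γ := fun t ht ↦ by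
    filter_upwards [hγnear t ht] with s hs
    exact (hΞ o hoW (γ s) hs).2
  have hβvel : ∀ t ∈ Ico a₁ b, velocity I (fun s ↦ expMap cov o (β s)) t = velocity I γ t :=
    fun t ht ↦ velocity_congr_of_eventuallyEq (I := I) (hβev t ht)
  have hβfut : ∀ t ∈ Ico a₁ b, τ.IsFutureDirected (velocity I (fun s ↦ expMap cov o (β s)) t) :=
    fun t ht ↦ by
      have hpt : expMap cov o (β t) = γ t := (hβev t ht).eq_of_nhds
      rw [hβvel t ht, hpt]
      exact (hγc t ht).2
  -- `Ξ o o = 0`, so `β a₁ = 0`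
  have hΞoo : Ξ o o = 0 := by
    have h1 : (o, Ξ o o) ∈ Src := (hΞ o hoW o hoW).1
    have h2 : (o, (0 : E)) ∈ Src := hS0 o hoW
    have heq : (fun w : M × E ↦ (w.1, expMap cov w.1 (e.symmL ℝ w.1 w.2))) (o, Ξ o o) =
        (fun w : M × E ↦ (w.1, expMap cov w.1 (e.symmL ℝ w.1 w.2))) (o, (0 : E)) := by
      show (o, expMap cov o (e.symmL ℝ o (Ξ o o))) = (o, expMap cov o (e.symmL ℝ o 0))
      rw [(hΞ o hoW o hoW).2, map_zero, expMap_zero (cov := cov) o]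
    exact (Prod.ext_iff.1 (hinjF h1 h2 heq)).2
  have hβa : β a₁ = 0 := by
    show L (K (γ a₁)) = 0
    rw [hK]
    show L (Ξ o (γ a₁)) = 0
    rw [← ho, hΞoo, map_zero]
  /- (B) the initial velocity of `β` is `γ'(a₁)`, future timelike (`d(exp_o)_0 = id`) -/
  have ha₁I : a₁ ∈ Ico a₁ b := ⟨le_rfl, ha₁b⟩
  have hβ'a : (β' a₁ : TangentSpace I o) = velocity I γ a₁ := by
    -- chain rule for `exp_o ∘ β` at `a₁`, where `β a₁ = 0`
    set ex : E → M := fun u ↦ expMap cov o (show TangentSpace I o from u) with hex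
    have hexd : MDifferentiableAt 𝓘(ℝ, E) I ex 0 :=
      (contMDiffAt_expMap_zero (cov := cov) o).mdifferentiableAt (by simp)
    have hexd' : MDifferentiableAt 𝓘(ℝ, E) I ex (β a₁) := by rw [hβa]; exact hexd
    have hβm : HasMFDerivAt 𝓘(ℝ, ℝ) 𝓘(ℝ, E) β a₁
        ((ContinuousLinearMap.id ℝ ℝ).smulRight (β' a₁)) :=
      hasMFDerivAt_iff_hasFDerivAt.2 (hβd a₁ ha₁I).hasFDerivAt
    have hcomp : HasMFDerivAt 𝓘(ℝ, ℝ) I (ex ∘ β) a₁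
        ((mfderiv 𝓘(ℝ, E) I ex (β a₁)).comp ((ContinuousLinearMap.id ℝ ℝ).smulRight (β' a₁))) :=
      hexd'.hasMFDerivAt.comp a₁ hβm
    have hvel : velocity I (ex ∘ β) a₁ = mfderiv 𝓘(ℝ, E) I ex (β a₁) (β' a₁) := by
      show mfderiv 𝓘(ℝ, ℝ) I (ex ∘ β) a₁ 1 = _
      rw [hcomp.mfderiv]
      show (mfderiv 𝓘(ℝ, E) I ex (β a₁)) (((ContinuousLinearMap.id ℝ ℝ).smulRight (β' a₁)) 1) = _
      simp
    rw [hβa, mfderiv_expMap_zero (cov := cov) o] at hvel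
    have h2 : velocity I (ex ∘ β) a₁ = velocity I γ a₁ := hβvel a₁ ha₁I
    rw [← h2]
    exact hvel.symm
  have hCo : IsOpen {v : TangentSpace I o | g.IsTimelike v ∧ τ.IsFutureDirected v} :=
    τ.isOpen_setOf_isTimelike_and_isFutureDirected o
  have hβ'aC : g.IsTimelike (x := o) (β' a₁) ∧ τ.IsFutureDirected (x := o) (β' a₁) := by
    rw [hβ'a]; exact (hγ₁ a₁ ha₁I).2
  /- (C) `β` enters the open future timecone immediately after `a₁` -/
  obtain ⟨t₁, ht₁, hβt₁⟩ : ∃ t₁ ∈ Ioo a₁ b,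
      g.IsTimelike (x := o) (β t₁) ∧ τ.IsFutureDirected (x := o) (β t₁) := by
    have hslope : Tendsto (slope β a₁) (𝓝[≠] a₁) (𝓝 (β' a₁)) :=
      (hβd a₁ ha₁I).tendsto_slope
    have hslope' : Tendsto (slope β a₁) (𝓝[>] a₁) (𝓝 (β' a₁)) :=
      hslope.mono_left (nhdsWithin_mono _ fun t (ht : a₁ < t) ↦ ne_of_gt ht)
    have hev : ∀ᶠ t in 𝓝[>] a₁,
        slope β a₁ t ∈ {v : TangentSpace I o | g.IsTimelike v ∧ τ.IsFutureDirected v} :=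
      hslope' (hCo.mem_nhds hβ'aC)
    have hev' : ∀ᶠ t in 𝓝[>] a₁, t ∈ Ioo a₁ b := Ioo_mem_nhdsGT ha₁b
    obtain ⟨t₁, ht₁C, ht₁⟩ := (hev.and hev').exists
    refine ⟨t₁, ht₁, ?_⟩
    have hpos : 0 < t₁ - a₁ := sub_pos.2 ht₁.1
    have hrepr : β t₁ = (t₁ - a₁) • slope β a₁ t₁ := by
      rw [slope_def_module, hβa, sub_zero, smul_smul, mul_inv_cancel₀ hpos.ne', one_smul]
    obtain ⟨h1, h2⟩ := ht₁C
    rw [hrepr]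
    exact ⟨h1.smul hpos.ne', h2.smul hpos⟩
  /- (D) from `t₁` on, `g_o(β, β)` is strictly decreasing: `g_o(β t, β t) < g_o(β t₁, β t₁) < 0` -/
  set c : ℝ := g.val o (β t₁) (β t₁) with hc
  have hc0 : c < 0 := hβt₁.1
  have hdec : ∀ t ∈ Ioo t₁ b, g.val o (β t) (β t) < c ∧
      g.IsTimelike (x := o) (β t) ∧ τ.IsFutureDirected (x := o) (β t) := by
    intro t ht
    have hIcc : Icc t₁ t ⊆ Ico a₁ b := fun s hs ↦ ⟨ht₁.1.le.trans hs.1, lt_of_le_of_lt hs.2 ht.2⟩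
    obtain ⟨hall, hanti⟩ := radial_timecone_invariance τ hn (a := t₁) (b := t)
      (fun s hs ↦ hβd s (hIcc hs)) (fun s hs ↦ hβdom s (hIcc hs)) (fun s hs ↦ hβfut s (hIcc hs))
      hβt₁.1 hβt₁.2
    exact ⟨hanti (left_mem_Icc.2 ht.1.le) (right_mem_Icc.2 ht.1.le) ht.1, hall t (right_mem_Icc.2 ht.1.le)⟩
  /- (E) the limit `v = exp_o⁻¹(m)` of `β` is future timelike -/
  set v : E := L (K m) with hv
  have hvdom : (v : TangentSpace I o) ∈ expDomain cov o := (hSdom _ (hΞ o hoW m hmW).1).2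
  have hexpv : expMap cov o (v : TangentSpace I o) = m := (hΞ o hoW m hmW).2
  -- `β t → v` as `t → b⁻`
  have hβlim : Tendsto β (𝓝[<] b) (𝓝 v) := by
    have hKc : ContinuousAt K m := (hKs.contMDiffAt (hWo.mem_nhds hmW)).continuousAt
    have h1 : Tendsto (fun t ↦ K (γ t)) (𝓝[<] b) (𝓝 (K m)) := hKc.tendsto.comp hm
    exact (L.continuous.tendsto _).comp h1
  letI : NormedAddCommGroup (TangentSpace I o) := inferInstanceAs (NormedAddCommGroup E)
  letI : NormedSpace ℝ (TangentSpace I o) := inferInstanceAs (NormedSpace ℝ E)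
  have hQ₁c : Continuous fun w : TangentSpace I o ↦ g.val o w w :=
    (g.val o).continuous₂.comp (continuous_id.prodMk continuous_id)
  have hQ₂c : Continuous fun w : TangentSpace I o ↦ g.val o (τ.vectorField o) w :=
    (g.val o (τ.vectorField o)).continuous
  have hlim₁ : Tendsto (fun t ↦ g.val o (β t) (β t)) (𝓝[<] b) (𝓝 (g.val o v v)) :=
    (hQ₁c.tendsto v).comp hβlim
  have hlim₂ : Tendsto (fun t ↦ g.val o (τ.vectorField o) (β t)) (𝓝[<] b)
      (𝓝 (g.val o (τ.vectorField o) v)) :=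
    (hQ₂c.tendsto v).comp hβlim
  have hevI : ∀ᶠ t in 𝓝[<] b, t ∈ Ioo t₁ b := Ioo_mem_nhdsLT ht₁.2
  have hev₁ : ∀ᶠ t in 𝓝[<] b, g.val o (β t) (β t) ≤ c := by
    filter_upwards [hevI] with t ht
    exact (hdec t ht).1.le
  have hev₂ : ∀ᶠ t in 𝓝[<] b, g.val o (τ.vectorField o) (β t) ≤ 0 := by
    filter_upwards [hevI] with t ht
    exact (hdec t ht).2.2.2.le
  have h₁ : g.val o v v ≤ c := le_of_tendsto hlim₁ hev₁
  have h₂ : g.val o (τ.vectorField o) v ≤ 0 := le_of_tendsto hlim₂ hev₂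
  have hvt : g.IsTimelike (x := o) v := lt_of_le_of_lt h₁ hc0
  have hvf : τ.IsFutureDirected (x := o) v :=
    ⟨hvt.isCausal, lt_of_le_of_ne h₂
      (g.val_ne_zero_of_isTimelike_of_isCausal (τ.isTimelike o) hvt.isCausal)⟩
  /- (F) `m = exp_o v ∈ I⁺(o)` -/
  have h := expMap_mem_chronologicalFuture τ hvdom hvt hvf
  rw [hexpv] at h
  exact h

/-- **Time dual: a future timelike curve with a past endpoint `m` lies in the chronological
future of `m`**: if `γ` is a future timelike curve on `(a, b]` (`a < b`) and `γ(t) → m` as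
`t → a⁺`, then `γ b ∈ I⁺(m)` (apply `mem_chronologicalFuture_of_tendsto` to `t ↦ γ(−t)` and the
reversed time orientation). [cite: ONeillSemiRiemannian1983, Ch. 14, Lemma 14.2 (p. 402) and p. 402 (time duality)] -/
theorem LorentzianMetric.mem_chronologicalFuture_of_tendsto_right (hn : (∞ : ℕ∞ω) ≤ n)
    {γ : ℝ → M} {a b : ℝ} (hab : a < b) (hγ : g.IsFutureTimelikeCurveOn τ γ (Ioc a b))
    {m : M} (hm : Tendsto γ (𝓝[>] a) (𝓝 m)) :
    γ b ∈ g.chronologicalFuture τ {m} := by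
  -- the reversed curve `t ↦ γ(−t)` on `[−b, −a)` for `τ.reverse`, with future endpoint `m`
  have hγ' : g.IsFutureTimelikeCurveOn τ.reverse (fun t ↦ γ (-t)) (Ico (-b) (-a)) := by
    have h := hγ.comp_neg
    refine h.mono fun t ht ↦ ?_
    show -t ∈ Ioc a b
    exact ⟨by linarith [ht.2], by linarith [ht.1]⟩
  have hm' : Tendsto (fun t ↦ γ (-t)) (𝓝[<] (-a)) (𝓝 m) := by
    have hneg : Tendsto (fun t : ℝ ↦ -t) (𝓝[<] (-a)) (𝓝[>] a) := by
      have h1 : Tendsto (fun t : ℝ ↦ -t) (𝓝 (-a)) (𝓝 a) := by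
        simpa using (continuous_neg.tendsto (-a))
      refine h1.inf ?_
      rw [tendsto_principal_principal]
      intro t ht
      show a < -t
      have : t < -a := ht
      linarith
    exact hm.comp hneg
  have h := LorentzianMetric.mem_chronologicalFuture_of_tendsto τ.reverse hn (by linarith) hγ' hm'
  -- `m ∈ I⁺_{τ.reverse}(γ b) = I⁻(γ b)`, i.e. `γ b ∈ I⁺(m)`
  have h' : m ∈ g.chronologicalPast τ {γ (-(-b))} := h
  rw [neg_neg] at h'
  exact mem_chronologicalFuture_of_mem_chronologicalPast h'

/-! ### Spacetimes -/

/-- **Endpoint lemma in a spacetime**: a future timelike curve on `[a, b)` with future endpoint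
`m` has `m ∈ I⁺(γ a)` (the regularity instances of the smooth metric are discharged).
[cite: ONeillSemiRiemannian1983, Ch. 14, Lemma 14.2 (p. 402)] -/
theorem Spacetime.mem_chronologicalFuture_of_tendsto {d : ℕ} (𝓢 : Spacetime d)
    {γ : ℝ → 𝓢.carrier} {a b : ℝ} (hab : a < b)
    (hγ : 𝓢.metric.IsFutureTimelikeCurveOn 𝓢.timeOrientation γ (Ico a b))
    {m : 𝓢.carrier} (hm : Tendsto γ (𝓝[<] b) (𝓝 m)) :
    m ∈ 𝓢.metric.chronologicalFuture 𝓢.timeOrientation {γ a} := by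
  haveI : 𝓢.metric.HasLeviCivita := 𝓢.metric.toPseudoRiemannianMetric.hasLeviCivita
  haveI : CovariantDerivative.ContMDiffCovariantDerivative 𝓢.metric.leviCivita 1 :=
    ⟨𝓢.metric.isLocallyContMDiff_leviCivita_holds 1 (by exact_mod_cast le_top) univ isOpen_univ⟩
  exact LorentzianMetric.mem_chronologicalFuture_of_tendsto 𝓢.timeOrientation le_rfl hab hγ hm

/-- **Endpoint lemma in a spacetime, time dual**: a future timelike curve on `(a, b]` with past
endpoint `m` has `γ b ∈ I⁺(m)`. [cite: ONeillSemiRiemannian1983, Ch. 14, Lemma 14.2 (p. 402)] -/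
theorem Spacetime.mem_chronologicalFuture_of_tendsto_right {d : ℕ} (𝓢 : Spacetime d)
    {γ : ℝ → 𝓢.carrier} {a b : ℝ} (hab : a < b)
    (hγ : 𝓢.metric.IsFutureTimelikeCurveOn 𝓢.timeOrientation γ (Ioc a b))
    {m : 𝓢.carrier} (hm : Tendsto γ (𝓝[>] a) (𝓝 m)) :
    γ b ∈ 𝓢.metric.chronologicalFuture 𝓢.timeOrientation {m} := by
  haveI : 𝓢.metric.HasLeviCivita := 𝓢.metric.toPseudoRiemannianMetric.hasLeviCivita
  haveI : CovariantDerivative.ContMDiffCovariantDerivative 𝓢.metric.leviCivita 1 :=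
    ⟨𝓢.metric.isLocallyContMDiff_leviCivita_holds 1 (by exact_mod_cast le_top) univ isOpen_univ⟩
  exact LorentzianMetric.mem_chronologicalFuture_of_tendsto_right 𝓢.timeOrientation le_rfl hab hγ hm

end Literature.Geometry.Lorentzian

end
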